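import Summits.Ventures.PercRepro.C041EdgeDict
import Summits.Ventures.PercRepro.C041TreeEmb

/-!
# ROW C-041 — THE TREE DICTIONARY: the six-vector of every rooted marked tree zone IS mine-3's `ℓψ`-recursion (p6,
gen 31; C-041.md §15 (c), §19 (b) — THEOREM (trees) at the level of six-vectors, on the graph model)

`treeVec t` is the recursion «the root's marks times `ℓψ` of each child»: `treeVec (node p q d cs) =
V(1^p, 0^q) · ∏_j ℓψ(treeVec (cs j))`.  By THE EDGE DICTIONARY (`sixVec_edgePendant`), Π multiplicative at the
anchor (`AnchorGlue.sixVec_glue`) and the marked point (`sixVec_pointZone`), the tree model of `C041GlueFold`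
(`treeModel t`: the root's point glued with the edge-pendants of the children's models) has six-vector `treeVec t`
for EVERY choice of the finiteness instances (`sixVec_treeModel`), and through the embedding `treeEmb` of
`C041TreeEmb` so does mine-3's canonical zone `t.toZone` (**`sixVec_toZone`**).  Hence mine-3's tree recursion
`TZ.counts` (`C041TreeZone`) and THEOREM (trees) in cone form (`inCone_sixVec_toZone`) are statements about one
and the same vector, `treeVec t = Π(t.toZone)`.
-/

namespace PercRepro

namespace ZoneZ

namespace AZone

open ZoneData TreeClosure Pendant AnchorGlue PointZone Finset

/-- **The `ℓψ`-recursion of a rooted marked tree**: the root's pure vector times `ℓψ` of each child. -/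
noncomputable def treeVec : TZ → Vec6
  | .node p q _ cs => (1 : Vec6) * v 1 ^ p * v 0 ^ q * ∏ j, ellv (treeVec (cs j))

/-- The recursion, spelled out. -/
theorem treeVec_node (p q : ℕ) {d : ℕ} (cs : Fin d → TZ) :
    treeVec (.node p q d cs) = (1 : Vec6) * v 1 ^ p * v 0 ^ q * ∏ j, ellv (treeVec (cs j)) := by
  rw [treeVec]

/-- The six-vector of the marked point, for every choice of the instances. -/
theorem sixVec_point' (p q : ℕ) (iE : Fintype (point p q).E) (dE : DecidableEq (point p q).E)
    (i₁ : Fintype (point p q).T₁) (d₁ : DecidableEq (point p q).T₁) (i₂ : Fintype (point p q).T₂)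
    (d₂ : DecidableEq (point p q).T₂) :
    @sixVec _ _ _ _ (point p q).Z (point p q).k iE dE i₁ d₁ i₂ d₂ = (1 : Vec6) * v 1 ^ p * v 0 ^ q := by
  convert sixVec_pointZone p q

/-- The edge dictionary, for every choice of the instances. -/
theorem sixVec_edgePendant' (A : AZone) (F : Vec6)
    (hA : ∀ (iE : Fintype A.E) (dE : DecidableEq A.E) (i₁ : Fintype A.T₁) (d₁ : DecidableEq A.T₁)
      (i₂ : Fintype A.T₂) (d₂ : DecidableEq A.T₂), @sixVec _ _ _ _ A.Z A.k iE dE i₁ d₁ i₂ d₂ = F)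
    (iE : Fintype (edgePendant A).E) (dE : DecidableEq (edgePendant A).E) (i₁ : Fintype (edgePendant A).T₁)
    (d₁ : DecidableEq (edgePendant A).T₁) (i₂ : Fintype (edgePendant A).T₂)
    (d₂ : DecidableEq (edgePendant A).T₂) :
    @sixVec _ _ _ _ (edgePendant A).Z (edgePendant A).k iE dE i₁ d₁ i₂ d₂ = ellv F := by
  haveI : Finite (Unit ⊕ A.E) := Finite.of_fintype _
  haveI : Finite A.E := Finite.of_injective (Sum.inr : A.E → Unit ⊕ A.E) Sum.inr_injective
  letI jE : Fintype A.E := Fintype.ofFinite A.E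
  letI eE : DecidableEq A.E := Classical.decEq A.E
  cases Subsingleton.elim iE (@instFintypeSum Unit A.E _ jE)
  cases Subsingleton.elim dE (@instDecidableEqSum Unit A.E _ eE)
  rw [← hA jE eE i₁ d₁ i₂ d₂]
  exact sixVec_edgePendant A.Z A.k

/-- Gluing at the anchor multiplies, for every choice of the instances. -/
theorem sixVec_glue' (A B : AZone) (FA FB : Vec6)
    (hA : ∀ (iE : Fintype A.E) (dE : DecidableEq A.E) (i₁ : Fintype A.T₁) (d₁ : DecidableEq A.T₁)
      (i₂ : Fintype A.T₂) (d₂ : DecidableEq A.T₂), @sixVec _ _ _ _ A.Z A.k iE dE i₁ d₁ i₂ d₂ = FA)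
    (hB : ∀ (iE : Fintype B.E) (dE : DecidableEq B.E) (i₁ : Fintype B.T₁) (d₁ : DecidableEq B.T₁)
      (i₂ : Fintype B.T₂) (d₂ : DecidableEq B.T₂), @sixVec _ _ _ _ B.Z B.k iE dE i₁ d₁ i₂ d₂ = FB)
    (iE : Fintype (glue A B).E) (dE : DecidableEq (glue A B).E) (i₁ : Fintype (glue A B).T₁)
    (d₁ : DecidableEq (glue A B).T₁) (i₂ : Fintype (glue A B).T₂) (d₂ : DecidableEq (glue A B).T₂) :
    @sixVec _ _ _ _ (glue A B).Z (glue A B).k iE dE i₁ d₁ i₂ d₂ = FA * FB := by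
  haveI : Finite (A.E ⊕ B.E) := Finite.of_fintype _
  haveI : Finite (A.T₁ ⊕ B.T₁) := Finite.of_fintype _
  haveI : Finite (A.T₂ ⊕ B.T₂) := Finite.of_fintype _
  haveI : Finite A.E := Finite.of_injective (Sum.inl : A.E → A.E ⊕ B.E) Sum.inl_injective
  haveI : Finite B.E := Finite.of_injective (Sum.inr : B.E → A.E ⊕ B.E) Sum.inr_injective
  haveI : Finite A.T₁ := Finite.of_injective (Sum.inl : A.T₁ → A.T₁ ⊕ B.T₁) Sum.inl_injective
  haveI : Finite B.T₁ := Finite.of_injective (Sum.inr : B.T₁ → A.T₁ ⊕ B.T₁) Sum.inr_injective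
  haveI : Finite A.T₂ := Finite.of_injective (Sum.inl : A.T₂ → A.T₂ ⊕ B.T₂) Sum.inl_injective
  haveI : Finite B.T₂ := Finite.of_injective (Sum.inr : B.T₂ → A.T₂ ⊕ B.T₂) Sum.inr_injective
  letI jEA : Fintype A.E := Fintype.ofFinite A.E
  letI jEB : Fintype B.E := Fintype.ofFinite B.E
  letI j₁A : Fintype A.T₁ := Fintype.ofFinite A.T₁
  letI j₁B : Fintype B.T₁ := Fintype.ofFinite B.T₁
  letI j₂A : Fintype A.T₂ := Fintype.ofFinite A.T₂
  letI j₂B : Fintype B.T₂ := Fintype.ofFinite B.T₂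
  letI eEA : DecidableEq A.E := Classical.decEq A.E
  letI eEB : DecidableEq B.E := Classical.decEq B.E
  letI e₁A : DecidableEq A.T₁ := Classical.decEq A.T₁
  letI e₁B : DecidableEq B.T₁ := Classical.decEq B.T₁
  letI e₂A : DecidableEq A.T₂ := Classical.decEq A.T₂
  letI e₂B : DecidableEq B.T₂ := Classical.decEq B.T₂
  cases Subsingleton.elim iE (@instFintypeSum A.E B.E jEA jEB)
  cases Subsingleton.elim dE (@instDecidableEqSum A.E B.E eEA eEB)
  cases Subsingleton.elim i₁ (@instFintypeSum A.T₁ B.T₁ j₁A j₁B)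
  cases Subsingleton.elim d₁ (@instDecidableEqSum A.T₁ B.T₁ e₁A e₁B)
  cases Subsingleton.elim i₂ (@instFintypeSum A.T₂ B.T₂ j₂A j₂B)
  cases Subsingleton.elim d₂ (@instDecidableEqSum A.T₂ B.T₂ e₂A e₂B)
  rw [← hA jEA eEA j₁A e₁A j₂A e₂A, ← hB jEB eEB j₁B e₁B j₂B e₂B]
  exact AnchorGlue.sixVec_glue A.Z A.k B.Z B.k

/-- The iterated gluing multiplies. -/
theorem sixVec_foldGlue : ∀ (d : ℕ) (f : Fin d → AZone) (acc : AZone) (F : Fin d → Vec6) (Facc : Vec6),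
    (∀ j (iE : Fintype (f j).E) (dE : DecidableEq (f j).E) (i₁ : Fintype (f j).T₁) (d₁ : DecidableEq (f j).T₁)
      (i₂ : Fintype (f j).T₂) (d₂ : DecidableEq (f j).T₂), @sixVec _ _ _ _ (f j).Z (f j).k iE dE i₁ d₁ i₂ d₂ = F j) →
    (∀ (iE : Fintype acc.E) (dE : DecidableEq acc.E) (i₁ : Fintype acc.T₁) (d₁ : DecidableEq acc.T₁)
      (i₂ : Fintype acc.T₂) (d₂ : DecidableEq acc.T₂), @sixVec _ _ _ _ acc.Z acc.k iE dE i₁ d₁ i₂ d₂ = Facc) →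
    ∀ (iE : Fintype (foldGlue d f acc).E) (dE : DecidableEq (foldGlue d f acc).E)
      (i₁ : Fintype (foldGlue d f acc).T₁) (d₁ : DecidableEq (foldGlue d f acc).T₁)
      (i₂ : Fintype (foldGlue d f acc).T₂) (d₂ : DecidableEq (foldGlue d f acc).T₂),
      @sixVec _ _ _ _ (foldGlue d f acc).Z (foldGlue d f acc).k iE dE i₁ d₁ i₂ d₂ = Facc * ∏ j, F j
  | 0, _, acc, _, Facc, _, hacc, iE, dE, i₁, d₁, i₂, d₂ => by
    rw [Finset.univ_eq_empty, Finset.prod_empty, mul_one]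
    exact hacc iE dE i₁ d₁ i₂ d₂
  | d + 1, f, acc, F, Facc, hf, hacc, iE, dE, i₁, d₁, i₂, d₂ => by
    rw [Fin.prod_univ_castSucc, ← mul_assoc]
    exact sixVec_glue' (foldGlue d (fun j => f j.castSucc) acc) (f (Fin.last d)) _ _
      (sixVec_foldGlue d (fun j => f j.castSucc) acc (fun j => F j.castSucc) Facc (fun j => hf j.castSucc) hacc)
      (hf (Fin.last d)) iE dE i₁ d₁ i₂ d₂

/-- **THE TREE DICTIONARY on the tree model**: its six-vector is the `ℓψ`-recursion, for every choice of the
instances. -/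
theorem sixVec_treeModel : ∀ (t : TZ) (iE : Fintype (treeModel t).E) (dE : DecidableEq (treeModel t).E)
    (i₁ : Fintype (treeModel t).T₁) (d₁ : DecidableEq (treeModel t).T₁) (i₂ : Fintype (treeModel t).T₂)
    (d₂ : DecidableEq (treeModel t).T₂),
    @sixVec _ _ _ _ (treeModel t).Z (treeModel t).k iE dE i₁ d₁ i₂ d₂ = treeVec t
  | .node p q d cs, iE, dE, i₁, d₁, i₂, d₂ => by
    rw [treeVec_node]
    exact sixVec_foldGlue d (fun j => edgePendant (treeModel (cs j))) (point p q)
      (fun j => ellv (treeVec (cs j))) ((1 : Vec6) * v 1 ^ p * v 0 ^ q)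
      (fun j => sixVec_edgePendant' (treeModel (cs j)) (treeVec (cs j)) (sixVec_treeModel (cs j)))
      (sixVec_point' p q) iE dE i₁ d₁ i₂ d₂

/-- **THE TREE DICTIONARY**: the six-vector of mine-3's canonical zone of every rooted marked tree is the
`ℓψ`-recursion `treeVec t`. -/
theorem sixVec_toZone (t : TZ) : t.toZone.sixVec t.root = treeVec t := by
  haveI : Finite (treeModel t).E := Finite.of_equiv _ (treeEmb t).e
  haveI : Finite (treeModel t).T₁ := Finite.of_equiv _ (treeEmb t).t₁
  haveI : Finite (treeModel t).T₂ := Finite.of_equiv _ (treeEmb t).t₂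
  letI jE : Fintype (treeModel t).E := Fintype.ofFinite _
  letI j₁ : Fintype (treeModel t).T₁ := Fintype.ofFinite _
  letI j₂ : Fintype (treeModel t).T₂ := Fintype.ofFinite _
  letI eE : DecidableEq (treeModel t).E := Classical.decEq _
  letI e₁ : DecidableEq (treeModel t).T₁ := Classical.decEq _
  letI e₂ : DecidableEq (treeModel t).T₂ := Classical.decEq _
  rw [← ZoneEmb.sixVec_eq (treeEmb t) t.root, treeEmb_v_root]
  exact sixVec_treeModel t jE eE j₁ e₁ j₂ e₂


/-! ## The recursion agrees with mine-3's `TZ.counts` -/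

/-- The coordinates of the root's pure vector `V(1^p, 0^q)`. -/
theorem pure_coords (p q : ℕ) :
    ((1 : Vec6) * v 1 ^ p * v 0 ^ q) 0 = 1 ∧ ((1 : Vec6) * v 1 ^ p * v 0 ^ q) 1 = 2 ^ p ∧
      ((1 : Vec6) * v 1 ^ p * v 0 ^ q) 2 = 2 ^ q ∧
      ((1 : Vec6) * v 1 ^ p * v 0 ^ q) 3 = (if p = 0 ∧ q = 0 then 1 else 0) ∧
      ((1 : Vec6) * v 1 ^ p * v 0 ^ q) 4 = (if q = 0 then 1 else 0) ∧
      ((1 : Vec6) * v 1 ^ p * v 0 ^ q) 5 = (if p = 0 then 1 else 0) := by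
  simp only [Pi.mul_apply, Pi.pow_apply, Pi.one_apply, v, Matrix.cons_val]
  by_cases hp : p = 0 <;> by_cases hq : q = 0 <;> norm_num [hp, hq]

/-- **THE RECURSIONS AGREE**: mine-3's four counts `TZ.counts t` are the root 4-vector of `treeVec t`. -/
theorem treeVec_counts : ∀ t : TZ,
    t.counts = (treeVec t 0, treeVec t 1 - treeVec t 0, treeVec t 2 - treeVec t 0,
      treeVec t 4 + treeVec t 5 - treeVec t 3)
  | .node p q d cs => by
    have ih : ∀ j, (cs j).counts = (treeVec (cs j) 0, treeVec (cs j) 1 - treeVec (cs j) 0,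
        treeVec (cs j) 2 - treeVec (cs j) 0, treeVec (cs j) 4 + treeVec (cs j) 5 - treeVec (cs j) 3) :=
      fun j => treeVec_counts (cs j)
    rw [TZ.counts_node, treeVec_node]
    simp only [TZ.gF, TZ.t1F, TZ.t2F, TZ.kF, ih, Pi.mul_apply, Pi.pow_apply, Finset.prod_apply, ellv, ell, v,
      Matrix.cons_val, one_mul, one_pow]
    refine Prod.ext ?_ (Prod.ext ?_ (Prod.ext ?_ ?_))
    · norm_num
    · norm_num
    · norm_num
    · by_cases hp : p = 0 <;> by_cases hq : q = 0 <;> norm_num [hp, hq]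

/-- mine-3's counts of a tree are the root 4-vector of the six-vector of its canonical zone. -/
theorem counts_eq_sixVec_toZone (t : TZ) :
    t.counts = (t.toZone.sixVec t.root 0, t.toZone.sixVec t.root 1 - t.toZone.sixVec t.root 0,
      t.toZone.sixVec t.root 2 - t.toZone.sixVec t.root 0,
      t.toZone.sixVec t.root 4 + t.toZone.sixVec t.root 5 - t.toZone.sixVec t.root 3) := by
  rw [sixVec_toZone]
  exact treeVec_counts t

end AZone

end ZoneZ

end PercRepro
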